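import Mathlib
import HarnessLib
import Summits.ValiantsHypothesis.ValiantsHypothesis.Theses.MonotoneRestoration
import Literature.Computability.AlgebraicComplexity.SymmetricOrbitCircuitEval

/-!
# The sparse / polylog-degree regime of `MonotoneRestorationQP` (crux `stmt-ValiantsHypothesis-15886`)

Helper file (`--supports stmt-ValiantsHypothesis-15886`, registered sub-goal
`monotoneRestorationQP_of_polylogDegree`) of line `Sketch`.  The crux
`Summit.ValiantsHypothesis.ValiantsHypothesis.Theses.MonotoneRestoration.MonotoneRestorationQP`
asks for quasi-polynomial SIZE square-symmetric circuits for matrix-symmetric families of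
polynomial degree and polynomial MONOTONE complexity.  Its conclusion holds with no complexity
hypothesis at all in the degenerate regime recorded here (via the orbit circuit of
`Literature.Computability.AlgebraicComplexity.OrbitCircuit`):

* `monotoneRestorationQP_of_qpSparse` — families with `≤ 2^((log₂ n + c)^c)` monomials and total
  degree `≤ 2^((log₂ n + c)^c)`;
* `monotoneRestorationQP_of_polylogDegree` — families of total degree `≤ (log₂ n + c)^c`
  (they have `≤ (n² + 1)^deg` monomials);
* `monotoneRestorationQP_restricted_polylogDegree` — the crux verbatim with its degree clause
  strengthened to polylog (complexity clause unused).

Census consequence for the line (nothing more is claimed): a counterexample to the crux has degree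
`(log n)^{ω(1)}` and `2^{ω(polylog n)}` monomials.
-/

-- `ValiantsHypothesis.ValiantsHypothesis`: the D-0017 layout repeats the problem name in the path.
set_option linter.dupNamespace false

noncomputable section

namespace Summit.ValiantsHypothesis.ValiantsHypothesis.Theorems

open Literature.Computability.AlgebraicComplexity MvPolynomial

namespace SparseRegime

/-! ### Quasi-polynomial arithmetic -/

/-- Size bookkeeping: `n² + S n² D + 2S + 1 ≤ 2^((log₂ n + c')^c')` when `S, D ≤ 2^((log₂ n + c)^c)`
(`c' = c + 4`). [folklore] -/
theorem qpSparse_size_le (c : ℕ) : ∃ c' : ℕ, ∀ n S D : ℕ,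
    S ≤ 2 ^ ((Nat.log 2 n + c) ^ c) → D ≤ 2 ^ ((Nat.log 2 n + c) ^ c) →
    n * n + S * (n * n * D) + S + S + 1 ≤ 2 ^ ((Nat.log 2 n + c') ^ c') := by
  refine ⟨c + 4, fun n S D hS hD => ?_⟩
  have hL : n < 2 ^ (Nat.log 2 n + 1) := Nat.lt_pow_succ_log_self Nat.one_lt_two n
  generalize Nat.log 2 n = L at hL hS hD ⊢
  set M : ℕ := (L + c) ^ c with hM
  set B : ℕ := L + (c + 4) with hB
  set E : ℕ := M + (2 * L + 2) + M with hE
  have hn : n * n ≤ 2 ^ (2 * L + 2) := by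
    calc n * n ≤ 2 ^ (L + 1) * 2 ^ (L + 1) := Nat.mul_le_mul hL.le hL.le
      _ = 2 ^ (2 * L + 2) := by rw [← pow_add]; ring_nf
  have h2 : S * (n * n * D) ≤ 2 ^ E := by
    calc S * (n * n * D) ≤ 2 ^ M * (2 ^ (2 * L + 2) * 2 ^ M) :=
          Nat.mul_le_mul hS (Nat.mul_le_mul hn hD)
      _ = 2 ^ E := by rw [hE, pow_add, pow_add]; ring
  have h1 : 2 ^ (2 * L + 2) ≤ 2 ^ E := Nat.pow_le_pow_right (by norm_num) (by omega)
  have h3 : 2 ^ M * 2 ≤ 2 ^ E := by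
    rw [← pow_succ]; exact Nat.pow_le_pow_right (by norm_num) (by omega)
  have h4 : 1 ≤ 2 ^ E := Nat.one_le_two_pow
  have hE4 : 2 ^ (E + 2) = 2 ^ E * 4 := by rw [pow_add]; norm_num
  -- the exponent
  have hB4 : 4 ≤ B := by omega
  have hB1 : 1 ≤ B := by omega
  have hMB : M ≤ B ^ c := Nat.pow_le_pow_left (by omega) c
  have hexp : E + 2 ≤ B ^ (c + 4) := by
    have hBc : B ^ c ≤ B ^ (c + 1) := Nat.pow_le_pow_right hB1 (by omega)
    have hBB : B ≤ B ^ (c + 1) := by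
      calc B = B ^ 1 := (pow_one B).symm
        _ ≤ B ^ (c + 1) := Nat.pow_le_pow_right hB1 (by omega)
    calc E + 2 = 2 * M + 2 * L + 4 := by rw [hE]; ring
      _ ≤ 2 * B ^ c + 2 * B := by omega
      _ ≤ 4 * B ^ (c + 1) := by omega
      _ ≤ B * B ^ (c + 1) := Nat.mul_le_mul_right _ hB4
      _ = B ^ (c + 2) := by rw [mul_comm, ← pow_succ]
      _ ≤ B ^ (c + 4) := Nat.pow_le_pow_right hB1 (by omega)
  calc n * n + S * (n * n * D) + S + S + 1
      ≤ 2 ^ (2 * L + 2) + 2 ^ E + 2 ^ M + 2 ^ M + 1 := by omega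
    _ ≤ 2 ^ E * 4 := by omega
    _ = 2 ^ (E + 2) := hE4.symm
    _ ≤ 2 ^ (B ^ (c + 4)) := Nat.pow_le_pow_right (by norm_num) hexp

/-- Degree bookkeeping: `(n² + 1)^d` and `d` are quasi-polynomial when `d ≤ (log₂ n + c)^c`
(`c₁ = c + 2`). [folklore] -/
theorem polylogDegree_sparse_le (c : ℕ) : ∃ c₁ : ℕ, ∀ n d : ℕ, d ≤ (Nat.log 2 n + c) ^ c →
    (n * n + 1) ^ d ≤ 2 ^ ((Nat.log 2 n + c₁) ^ c₁) ∧ d ≤ 2 ^ ((Nat.log 2 n + c₁) ^ c₁) := by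
  refine ⟨c + 2, fun n d hd => ?_⟩
  have hL : n < 2 ^ (Nat.log 2 n + 1) := Nat.lt_pow_succ_log_self Nat.one_lt_two n
  generalize Nat.log 2 n = L at hL hd ⊢
  set M : ℕ := (L + c) ^ c with hM
  set B : ℕ := L + (c + 2) with hB
  have hB2 : 2 ≤ B := by omega
  have hB1 : 1 ≤ B := by omega
  have hMB : M ≤ B ^ c := Nat.pow_le_pow_left (by omega) c
  have hexp : (2 * L + 2) * M ≤ B ^ (c + 2) := by
    calc (2 * L + 2) * M ≤ (2 * B) * B ^ c := Nat.mul_le_mul (by omega) hMB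
      _ = 2 * B ^ (c + 1) := by rw [pow_succ]; ring
      _ ≤ B * B ^ (c + 1) := Nat.mul_le_mul_right _ hB2
      _ = B ^ (c + 2) := by rw [mul_comm, ← pow_succ]
  have hn : n * n + 1 ≤ 2 ^ (2 * L + 2) := by
    have h1 : n + 1 ≤ 2 ^ (L + 1) := hL
    calc n * n + 1 ≤ (n + 1) * (n + 1) := by nlinarith
      _ ≤ 2 ^ (L + 1) * 2 ^ (L + 1) := Nat.mul_le_mul h1 h1
      _ = 2 ^ (2 * L + 2) := by rw [← pow_add]; ring_nf
  constructor
  · calc (n * n + 1) ^ d ≤ (2 ^ (2 * L + 2)) ^ d := Nat.pow_le_pow_left hn d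
      _ = 2 ^ ((2 * L + 2) * d) := (pow_mul _ _ _).symm
      _ ≤ 2 ^ ((2 * L + 2) * M) :=
          Nat.pow_le_pow_right (by norm_num) (Nat.mul_le_mul_left _ hd)
      _ ≤ 2 ^ (B ^ (c + 2)) := Nat.pow_le_pow_right (by norm_num) hexp
  · calc d ≤ M := hd
      _ ≤ B ^ c := hMB
      _ ≤ B ^ (c + 2) := Nat.pow_le_pow_right hB1 (by omega)
      _ ≤ 2 ^ (B ^ (c + 2)) := (Nat.lt_two_pow_self).le

end SparseRegime

open Summit.ValiantsHypothesis.ValiantsHypothesis.Theses.MonotoneRestoration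

/-- **The conclusion of `MonotoneRestorationQP` in the quasi-polynomially SPARSE regime.** A
matrix-symmetric family over `ℝ≥0` with `≤ 2^((log₂ n + c)^c)` monomials and total degree
`≤ 2^((log₂ n + c)^c)` has square-symmetric circuits over `ℂ` of quasi-polynomial size computing
its complexification — whatever its monotone complexity (the orbit circuit
`OrbitCircuit.exists_symmetric_circuit_of_invariant`). [folklore] -/
theorem monotoneRestorationQP_of_qpSparse :
    ∀ f : (n : ℕ) → MvPolynomial (Fin n × Fin n) NNReal,
    (∀ (n : ℕ) (σ τ : Equiv.Perm (Fin n)),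
      MvPolynomial.rename (fun p : Fin n × Fin n => (σ p.1, τ p.2)) (f n) = f n) →
    (∃ c : ℕ, ∀ n : ℕ, (f n).support.card ≤ 2 ^ ((Nat.log 2 n + c) ^ c) ∧
      (f n).totalDegree ≤ 2 ^ ((Nat.log 2 n + c) ^ c)) →
    ∃ c : ℕ, ∀ n : ℕ, ∃ (G : Type) (_ : Fintype G)
      (C : LabelledArithCircuit ℂ (Fin n × Fin n) Unit G),
      C.IsSymmetric (Equiv.Perm (Fin n)) ∧
      C.eval (C.output ()) = MvPolynomial.map (Complex.ofRealHom.comp NNReal.toRealHom) (f n) ∧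
      Fintype.card G ≤ 2 ^ ((Nat.log 2 n + c) ^ c) := by
  intro f hsym ⟨c, hc⟩
  obtain ⟨c', hc'⟩ := SparseRegime.qpSparse_size_le c
  refine ⟨c', fun n => ?_⟩
  set q : MvPolynomial (Fin n × Fin n) ℂ :=
    MvPolynomial.map (Complex.ofRealHom.comp NNReal.toRealHom) (f n) with hq
  have hinv : ∀ σ : Equiv.Perm (Fin n), rename (fun pq : Fin n × Fin n => σ • pq) q = q := by
    intro σ
    rw [hq, ← map_rename]
    exact congrArg _ (hsym n σ σ)
  obtain ⟨G, inst, C, hCs, hCe, hCc⟩ := OrbitCircuit.exists_symmetric_circuit_of_invariant q hinv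
  refine ⟨G, inst, C, hCs, hCe, hCc.trans (hc' n _ _ ?_ ?_)⟩
  · exact (Finset.card_le_card (support_map_subset _ _)).trans (hc n).1
  · exact le_trans (Finset.sup_mono (support_map_subset _ _)) (hc n).2

/-- **The conclusion of `MonotoneRestorationQP` in the POLYLOGARITHMIC-DEGREE regime.** A
matrix-symmetric family over `ℝ≥0` of total degree `≤ (log₂ n + c)^c` has square-symmetric
circuits over `ℂ` of quasi-polynomial size (it has `≤ (n² + 1)^deg` monomials,
`OrbitCircuit.card_support_le_of_totalDegree_le`).  Hence a counterexample to the crux needs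
degree `(log n)^{ω(1)}`. [folklore] -/
theorem monotoneRestorationQP_of_polylogDegree :
    ∀ f : (n : ℕ) → MvPolynomial (Fin n × Fin n) NNReal,
    (∀ (n : ℕ) (σ τ : Equiv.Perm (Fin n)),
      MvPolynomial.rename (fun p : Fin n × Fin n => (σ p.1, τ p.2)) (f n) = f n) →
    (∃ c : ℕ, ∀ n : ℕ, (f n).totalDegree ≤ (Nat.log 2 n + c) ^ c) →
    ∃ c : ℕ, ∀ n : ℕ, ∃ (G : Type) (_ : Fintype G)
      (C : LabelledArithCircuit ℂ (Fin n × Fin n) Unit G),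
      C.IsSymmetric (Equiv.Perm (Fin n)) ∧
      C.eval (C.output ()) = MvPolynomial.map (Complex.ofRealHom.comp NNReal.toRealHom) (f n) ∧
      Fintype.card G ≤ 2 ^ ((Nat.log 2 n + c) ^ c) := by
  intro f hsym ⟨c, hc⟩
  obtain ⟨c₁, hc₁⟩ := SparseRegime.polylogDegree_sparse_le c
  refine monotoneRestorationQP_of_qpSparse f hsym ⟨c₁, fun n => ⟨?_, (hc₁ n _ (hc n)).2⟩⟩
  calc (f n).support.card ≤ (Fintype.card (Fin n × Fin n) + 1) ^ (f n).totalDegree :=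
        OrbitCircuit.card_support_le_of_totalDegree_le (f n) le_rfl
    _ = (n * n + 1) ^ (f n).totalDegree := by rw [Fintype.card_prod, Fintype.card_fin]
    _ ≤ 2 ^ ((Nat.log 2 n + c₁) ^ c₁) := (hc₁ n _ (hc n)).1

/-- **Corollary: `MonotoneRestorationQP` holds on the polylog-degree sub-class** — the crux
restricted to families of total degree `≤ (log₂ n + c)^c` (its complexity hypothesis unused).
[folklore] -/
theorem monotoneRestorationQP_restricted_polylogDegree :
    ∀ f : (n : ℕ) → MvPolynomial (Fin n × Fin n) NNReal,
    (∀ (n : ℕ) (σ τ : Equiv.Perm (Fin n)),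
      MvPolynomial.rename (fun p : Fin n × Fin n => (σ p.1, τ p.2)) (f n) = f n) →
    (∃ c : ℕ, ∀ n : ℕ, (f n).totalDegree ≤ (Nat.log 2 n + c) ^ c ∧
      Literature.Computability.AlgebraicComplexity.complexity (k := NNReal) (f n) ≤ (n + 2) ^ c) →
    ∃ c : ℕ, ∀ n : ℕ, ∃ (G : Type) (_ : Fintype G)
      (C : LabelledArithCircuit ℂ (Fin n × Fin n) Unit G),
      C.IsSymmetric (Equiv.Perm (Fin n)) ∧
      C.eval (C.output ()) = MvPolynomial.map (Complex.ofRealHom.comp NNReal.toRealHom) (f n) ∧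
      Fintype.card G ≤ 2 ^ ((Nat.log 2 n + c) ^ c) :=
  fun f hsym ⟨c, hc⟩ => monotoneRestorationQP_of_polylogDegree f hsym ⟨c, fun n => (hc n).1⟩

end Summit.ValiantsHypothesis.ValiantsHypothesis.Theorems

end

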